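import Literature.AlgebraicGeometry.Frobenioids.EquivalenceLinearOfPreSteps
import Literature.AlgebraicGeometry.Frobenioids.EquivalenceFrobeniusQuasiIsotropic
import HarnessLib

/-!
# Frobenioids I, §3: Theorem 3.4 (iii) from Theorem 3.4 (ii) — quasi-isotropic type: Frobenius degrees
# and the preservation list (pre-step preservation as a HYPOTHESIS)

Mochizuki, *The geometry of Frobenioids I: the general theory*, Kyushu J. Math. **62** (2008),
Thm. 3.4 (iii), proof, kurims p. 64: "Since the isotropification functor preserves Frobenius degrees,
this implies that `Ψ` maps morphisms of Frobenius degree `d` to morphisms of Frobenius degree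
`Ψ^{ℕ≥1}(d)`, hence that `Ψ` preserves linear morphisms and morphisms of Frobenius type [by Proposition
1.7, (iii)]. Moreover, by assertions (i), (ii), `Ψ` preserves isometric pre-steps and pre-steps, hence
base-isomorphisms …, pull-back morphisms [cf. Proposition 1.7, (ii)], isometries …"
[cite: MochizukiFrdI2008, Thm. 3.4 (iii) p.64].

PROOF-ONLY file (seat abc-iut-L1-t11; GAP-LEDGER row G-L1d8-1): seat abc-iut-L1-t13's
`EquivalenceFrobeniusQuasiIsotropic.lean` re-run with "`Ψ`, `Ψ⁻¹` preserve pre-steps" (hypotheses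
`hΨ`, `hΨ'` = the conclusion of Thm. 3.4 (ii), first clause, for `Ψ` and `Ψ⁻¹`) in place of "bases of
FSM-type". Standing hypotheses: `C₁`, `C₂` Frobenioids of quasi-isotropic type, `Φ₁`, `Φ₂` non-dilating,
non-group-like objects on both sides, `Ψ : C₁ ⥲ C₂`. Through `Ψ^istr` (Thm. 3.4 (i)) and isotropic hulls
the isotropic results of `EquivalenceLinearOfPreSteps.lean` give: `Ψ` preserves every Frobenius degree
(`FrdI.OfPreSteps.degFr_map`), linear morphisms, Frobenius type, base-isomorphisms, pull-backs,
isometries, co-angular and LB-invertible morphisms; packaged in the shape of the typed statement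
`PreFrobenioidData.Thm34iii` as `FrdI.OfPreSteps.thm34iii_morphisms`. No statement of the paper is
restated or strengthened.
-/

set_option backward.isDefEq.respectTransparency false

namespace Literature.AlgebraicGeometry.Frobenioids

open CategoryTheory Opposite

universe w v v' u u'

namespace FrdI

namespace OfPreSteps

section Two

variable {D₁ : Type u} [Category.{v} D₁] {Φ₁ : D₁ᵒᵖ ⥤ CommMonCat.{w}} {C₁ : Type u'}
  [Category.{v'} C₁] {D₂ : Type u} [Category.{v} D₂] {Φ₂ : D₂ᵒᵖ ⥤ CommMonCat.{w}} {C₂ : Type u'}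
  [Category.{v'} C₂] {F₁ : C₁ ⥤ ElemFrobenioid Φ₁} {F₂ : C₂ ⥤ ElemFrobenioid Φ₂}

/-- **Thm. 3.4 (iii): `Ψ` preserves the Frobenius degree of every morphism** — quasi-isotropic type,
`Φ₁`, `Φ₂` non-dilating, non-group-like objects on both sides, `Ψ`, `Ψ⁻¹` preserving pre-steps ("since
the isotropification functor preserves Frobenius degrees": through `Ψ^istr`, which again preserves
pre-steps in both directions, and isotropic hulls). [cite: MochizukiFrdI2008, Thm. 3.4 (iii) p.64] -/
theorem degFr_map (hF₁ : PreFrobenioid.IsFrobenioid F₁) (hF₂ : PreFrobenioid.IsFrobenioid F₂)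
    (hq₁ : (PreFrobenioidData.ofFunctor Φ₁ F₁).IsOfQuasiIsotropicType)
    (hq₂ : (PreFrobenioidData.ofFunctor Φ₂ F₂).IsOfQuasiIsotropicType) (hnd₁ : IsNonDilatingOn Φ₁)
    (hnd₂ : IsNonDilatingOn Φ₂) (Ψ : C₁ ≌ C₂)
    (hΨ : ∀ ⦃A B : C₁⦄ ⦃φ : A ⟶ B⦄, PreFrobenioid.IsPreStep F₁ φ →
      PreFrobenioid.IsPreStep F₂ (Ψ.functor.map φ))
    (hΨ' : ∀ ⦃A B : C₂⦄ ⦃φ : A ⟶ B⦄, PreFrobenioid.IsPreStep F₂ φ →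
      PreFrobenioid.IsPreStep F₁ (Ψ.inverse.map φ))
    {N₁ : C₁} (hN₁ : ¬ PreFrobenioid.IsGroupLikeObj F₁ N₁) {N₂ : C₂}
    (hN₂ : ¬ PreFrobenioid.IsGroupLikeObj F₂ N₂) {A B : C₁} (φ : A ⟶ B) :
    PreFrobenioid.degFr F₂ (Ψ.functor.map φ) = PreFrobenioid.degFr F₁ φ := by
  have hP₁ := hF₁.isPreFrobenioid
  have hP₂ := hF₂.isPreFrobenioid
  -- `Ψ^istr`
  haveI : (PreFrobenioid.isotropicObjects F₂).IsClosedUnderIsomorphisms :=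
    ⟨fun e hX => PreFrobenioid.IsIsotropic.of_iso hP₂ e.symm hX⟩
  let Ψi : PreFrobenioid.Istr F₁ ≌ PreFrobenioid.Istr F₂ :=
    Ψ.congrFullSubcategory (isotropicObjects_inverseImage hF₁ hq₁ hq₂ Ψ)
  -- `Ψ^istr` and its inverse preserve pre-steps (restriction of `hΨ`, `hΨ'`)
  have hΨi : ∀ ⦃a b : PreFrobenioid.Istr F₁⦄ ⦃f : a ⟶ b⦄,
      PreFrobenioid.IsPreStep (PreFrobenioid.istrFunctor F₁) f →
        PreFrobenioid.IsPreStep (PreFrobenioid.istrFunctor F₂) (Ψi.functor.map f) :=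
    fun a b f hf => hΨ (φ := f.hom) hf
  have hΨi' : ∀ ⦃a b : PreFrobenioid.Istr F₂⦄ ⦃f : a ⟶ b⦄,
      PreFrobenioid.IsPreStep (PreFrobenioid.istrFunctor F₂) f →
        PreFrobenioid.IsPreStep (PreFrobenioid.istrFunctor F₁) (Ψi.inverse.map f) :=
    fun a b f hf => hΨ' (φ := f.hom) hf
  obtain ⟨M₁, hM₁i, hM₁⟩ := exists_isotropic_not_isGroupLikeObj hF₁ hN₁
  obtain ⟨M₂, hM₂i, hM₂⟩ := exists_isotropic_not_isGroupLikeObj hF₂ hN₂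
  -- hulls and the induced arrow `φ'` between them
  obtain ⟨A', hA, hhA⟩ := hF₁.vii_a A
  obtain ⟨B', hB, hhB⟩ := hF₁.vii_a B
  obtain ⟨hiA, hpA, hA'i, hunivA⟩ := id hhA
  obtain ⟨hiB, hpB, hB'i, -⟩ := id hhB
  obtain ⟨φ', hφ', -⟩ := hunivA (φ ≫ hB) hB'i
  -- hφ' : hA ≫ φ' = φ ≫ hB
  have hdφ' : PreFrobenioid.degFr F₁ φ' = PreFrobenioid.degFr F₁ φ := by
    have := congrArg (PreFrobenioid.degFr F₁) hφ'
    rw [PreFrobenioid.degFr_comp, PreFrobenioid.degFr_comp, show PreFrobenioid.degFr F₁ hA = 1 from hpA.1,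
      show PreFrobenioid.degFr F₁ hB = 1 from hpB.1, one_mul, mul_one] at this
    exact this
  -- the isotropic result on `Ψ^istr`
  let a : PreFrobenioid.Istr F₁ := ⟨A', hA'i⟩
  let b : PreFrobenioid.Istr F₁ := ⟨B', hB'i⟩
  let f : a ⟶ b := ObjectProperty.homMk φ'
  have hcore : PreFrobenioid.degFr (PreFrobenioid.istrFunctor F₂) (Ψi.functor.map f) =
      PreFrobenioid.degFr (PreFrobenioid.istrFunctor F₁) f :=
    degFr_map_of_isotropic (PreFrobenioid.isFrobenioid_istr hF₁) (PreFrobenioid.isFrobenioid_istr hF₂)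
      (fun X => PreFrobenioid.isIsotropic_istr X) (fun X => PreFrobenioid.isIsotropic_istr X) hnd₁ hnd₂ Ψi
      hΨi hΨi' (N₁ := ⟨M₁, hM₁i⟩) hM₁ (N₂ := ⟨M₂, hM₂i⟩) hM₂ f
  have hΨφ' : PreFrobenioid.degFr F₂ (Ψ.functor.map φ') = PreFrobenioid.degFr F₁ φ' := hcore
  -- transfer along the hulls
  have hΨhA := (isIsometry_isPreStep_map hF₁ hF₂ hq₁ hq₂ Ψ hiA hpA).2
  have hΨhB := (isIsometry_isPreStep_map hF₁ hF₂ hq₁ hq₂ Ψ hiB hpB).2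
  have := congrArg (fun g => PreFrobenioid.degFr F₂ (Ψ.functor.map g)) hφ'
  simp only [Functor.map_comp, PreFrobenioid.degFr_comp] at this
  rw [show PreFrobenioid.degFr F₂ (Ψ.functor.map hA) = 1 from hΨhA.1,
    show PreFrobenioid.degFr F₂ (Ψ.functor.map hB) = 1 from hΨhB.1, one_mul, mul_one, hΨφ', hdφ'] at this
  exact this.symm

/-- **Thm. 3.4 (iii): `Ψ` preserves linear morphisms** (quasi-isotropic type).
[cite: MochizukiFrdI2008, Thm. 3.4 (iii) p.64] -/
theorem isLinear_map_quasiIsotropic (hF₁ : PreFrobenioid.IsFrobenioid F₁)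
    (hF₂ : PreFrobenioid.IsFrobenioid F₂) (hq₁ : (PreFrobenioidData.ofFunctor Φ₁ F₁).IsOfQuasiIsotropicType)
    (hq₂ : (PreFrobenioidData.ofFunctor Φ₂ F₂).IsOfQuasiIsotropicType) (hnd₁ : IsNonDilatingOn Φ₁)
    (hnd₂ : IsNonDilatingOn Φ₂) (Ψ : C₁ ≌ C₂)
    (hΨ : ∀ ⦃A B : C₁⦄ ⦃φ : A ⟶ B⦄, PreFrobenioid.IsPreStep F₁ φ →
      PreFrobenioid.IsPreStep F₂ (Ψ.functor.map φ))
    (hΨ' : ∀ ⦃A B : C₂⦄ ⦃φ : A ⟶ B⦄, PreFrobenioid.IsPreStep F₂ φ →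
      PreFrobenioid.IsPreStep F₁ (Ψ.inverse.map φ))
    {N₁ : C₁} (hN₁ : ¬ PreFrobenioid.IsGroupLikeObj F₁ N₁) {N₂ : C₂}
    (hN₂ : ¬ PreFrobenioid.IsGroupLikeObj F₂ N₂) {A B : C₁} {φ : A ⟶ B}
    (hφ : PreFrobenioid.IsLinear F₁ φ) : PreFrobenioid.IsLinear F₂ (Ψ.functor.map φ) := by
  change PreFrobenioid.degFr F₂ (Ψ.functor.map φ) = 1
  rw [degFr_map hF₁ hF₂ hq₁ hq₂ hnd₁ hnd₂ Ψ hΨ hΨ' hN₁ hN₂ φ]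
  exact hφ

/-- **Thm. 3.4 (iii): `Ψ` preserves morphisms of Frobenius type** (quasi-isotropic type; Prop. 1.7
(iii): minimal-coadjoint to the linear morphisms, which `Ψ⁻¹` preserves).
[cite: MochizukiFrdI2008, Thm. 3.4 (iii) p.64] -/
theorem isFrobeniusType_map_quasiIsotropic (hF₁ : PreFrobenioid.IsFrobenioid F₁)
    (hF₂ : PreFrobenioid.IsFrobenioid F₂) (hq₁ : (PreFrobenioidData.ofFunctor Φ₁ F₁).IsOfQuasiIsotropicType)
    (hq₂ : (PreFrobenioidData.ofFunctor Φ₂ F₂).IsOfQuasiIsotropicType) (hnd₁ : IsNonDilatingOn Φ₁)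
    (hnd₂ : IsNonDilatingOn Φ₂) (Ψ : C₁ ≌ C₂)
    (hΨ : ∀ ⦃A B : C₁⦄ ⦃φ : A ⟶ B⦄, PreFrobenioid.IsPreStep F₁ φ →
      PreFrobenioid.IsPreStep F₂ (Ψ.functor.map φ))
    (hΨ' : ∀ ⦃A B : C₂⦄ ⦃φ : A ⟶ B⦄, PreFrobenioid.IsPreStep F₂ φ →
      PreFrobenioid.IsPreStep F₁ (Ψ.inverse.map φ))
    {N₁ : C₁} (hN₁ : ¬ PreFrobenioid.IsGroupLikeObj F₁ N₁) {N₂ : C₂}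
    (hN₂ : ¬ PreFrobenioid.IsGroupLikeObj F₂ N₂) {A B : C₁} {φ : A ⟶ B}
    (hφ : PreFrobenioid.IsFrobeniusType F₁ φ) : PreFrobenioid.IsFrobeniusType F₂ (Ψ.functor.map φ) := by
  rw [PreFrobenioid.isFrobeniusType_iff_isMinimalCoadjoint F₂ hF₂]
  refine ((PreFrobenioid.isFrobeniusType_iff_isMinimalCoadjoint F₁ hF₁ φ).1 hφ).map_equivalence Ψ
    (S₂ := PreFrobenioid.linearMorphisms F₂) (fun X Y β hβ => ?_) (fun X Y Y' β j hj hβ => ?_)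
  · exact isLinear_map_quasiIsotropic hF₂ hF₁ hq₂ hq₁ hnd₂ hnd₁ Ψ.symm hΨ' hΨ hN₂ hN₁ hβ
  · haveI := hj
    exact PreFrobenioid.IsLinear.comp F₁ hβ (PreFrobenioid.isLinear_of_isIso F₁ j)

/-- **Thm. 3.4 (iii): `Ψ` preserves base-isomorphisms** (quasi-isotropic type; Prop. 1.7 (ii)).
[cite: MochizukiFrdI2008, Thm. 3.4 (iii) p.64] -/
theorem isBaseIso_map_quasiIsotropic (hF₁ : PreFrobenioid.IsFrobenioid F₁)
    (hF₂ : PreFrobenioid.IsFrobenioid F₂) (hq₁ : (PreFrobenioidData.ofFunctor Φ₁ F₁).IsOfQuasiIsotropicType)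
    (hq₂ : (PreFrobenioidData.ofFunctor Φ₂ F₂).IsOfQuasiIsotropicType) (hnd₁ : IsNonDilatingOn Φ₁)
    (hnd₂ : IsNonDilatingOn Φ₂) (Ψ : C₁ ≌ C₂)
    (hΨ : ∀ ⦃A B : C₁⦄ ⦃φ : A ⟶ B⦄, PreFrobenioid.IsPreStep F₁ φ →
      PreFrobenioid.IsPreStep F₂ (Ψ.functor.map φ))
    (hΨ' : ∀ ⦃A B : C₂⦄ ⦃φ : A ⟶ B⦄, PreFrobenioid.IsPreStep F₂ φ →
      PreFrobenioid.IsPreStep F₁ (Ψ.inverse.map φ))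
    {N₁ : C₁} (hN₁ : ¬ PreFrobenioid.IsGroupLikeObj F₁ N₁) {N₂ : C₂}
    (hN₂ : ¬ PreFrobenioid.IsGroupLikeObj F₂ N₂) {A B : C₁} {φ : A ⟶ B}
    (hφ : PreFrobenioid.IsBaseIso F₁ φ) : PreFrobenioid.IsBaseIso F₂ (Ψ.functor.map φ) := by
  obtain ⟨X, β, α, hfac, hβ, hα⟩ :=
    (PreFrobenioid.isBaseIso_iff_exists_frobeniusType_preStep F₁ hF₁ φ).1 hφ
  rw [← hfac, Functor.map_comp]
  exact PreFrobenioid.IsBaseIso.comp F₂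
    (isFrobeniusType_map_quasiIsotropic hF₁ hF₂ hq₁ hq₂ hnd₁ hnd₂ Ψ hΨ hΨ' hN₁ hN₂ hβ).2 (hΨ hα).2

/-- **Thm. 3.4 (iii): `Ψ` preserves pull-back morphisms** (quasi-isotropic type; Prop. 1.7 (ii):
minimal-adjoint to the base-isomorphisms, which `Ψ⁻¹` preserves). [cite: MochizukiFrdI2008, Thm. 3.4 (iii) p.64] -/
theorem isPullbackMorphism_map_quasiIsotropic (hF₁ : PreFrobenioid.IsFrobenioid F₁)
    (hF₂ : PreFrobenioid.IsFrobenioid F₂) (hq₁ : (PreFrobenioidData.ofFunctor Φ₁ F₁).IsOfQuasiIsotropicType)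
    (hq₂ : (PreFrobenioidData.ofFunctor Φ₂ F₂).IsOfQuasiIsotropicType) (hnd₁ : IsNonDilatingOn Φ₁)
    (hnd₂ : IsNonDilatingOn Φ₂) (Ψ : C₁ ≌ C₂)
    (hΨ : ∀ ⦃A B : C₁⦄ ⦃φ : A ⟶ B⦄, PreFrobenioid.IsPreStep F₁ φ →
      PreFrobenioid.IsPreStep F₂ (Ψ.functor.map φ))
    (hΨ' : ∀ ⦃A B : C₂⦄ ⦃φ : A ⟶ B⦄, PreFrobenioid.IsPreStep F₂ φ →
      PreFrobenioid.IsPreStep F₁ (Ψ.inverse.map φ))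
    {N₁ : C₁} (hN₁ : ¬ PreFrobenioid.IsGroupLikeObj F₁ N₁) {N₂ : C₂}
    (hN₂ : ¬ PreFrobenioid.IsGroupLikeObj F₂ N₂) {A B : C₁} {φ : A ⟶ B}
    (hφ : PreFrobenioid.IsPullbackMorphism F₁ φ) : PreFrobenioid.IsPullbackMorphism F₂ (Ψ.functor.map φ) := by
  rw [PreFrobenioid.isPullbackMorphism_iff_isMinimalAdjoint F₂ hF₂]
  refine ((PreFrobenioid.isPullbackMorphism_iff_isMinimalAdjoint F₁ hF₁ φ).1 hφ).map_equivalence Ψ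
    (S₂ := PreFrobenioid.baseIsomorphisms F₂) (fun X Y β hβ => ?_) (fun X X' Y i β hi hβ => ?_)
  · exact isBaseIso_map_quasiIsotropic hF₂ hF₁ hq₂ hq₁ hnd₂ hnd₁ Ψ.symm hΨ' hΨ hN₂ hN₁ hβ
  · haveI := hi
    exact PreFrobenioid.IsBaseIso.comp F₁ (PreFrobenioid.isBaseIso_of_isIso F₁ i) hβ

/-- **Thm. 3.4 (iii): `Ψ` preserves isometries** (quasi-isotropic type; Def. 1.3 (iv)(a) factorisation:
its three parts are a morphism of Frobenius type, an isometric pre-step (Thm. 3.4 (i)) and a pull-back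
morphism). [cite: MochizukiFrdI2008, Thm. 3.4 (iii) p.64] -/
theorem isIsometry_map_quasiIsotropic (hF₁ : PreFrobenioid.IsFrobenioid F₁)
    (hF₂ : PreFrobenioid.IsFrobenioid F₂) (hq₁ : (PreFrobenioidData.ofFunctor Φ₁ F₁).IsOfQuasiIsotropicType)
    (hq₂ : (PreFrobenioidData.ofFunctor Φ₂ F₂).IsOfQuasiIsotropicType) (hnd₁ : IsNonDilatingOn Φ₁)
    (hnd₂ : IsNonDilatingOn Φ₂) (Ψ : C₁ ≌ C₂)
    (hΨ : ∀ ⦃A B : C₁⦄ ⦃φ : A ⟶ B⦄, PreFrobenioid.IsPreStep F₁ φ →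
      PreFrobenioid.IsPreStep F₂ (Ψ.functor.map φ))
    (hΨ' : ∀ ⦃A B : C₂⦄ ⦃φ : A ⟶ B⦄, PreFrobenioid.IsPreStep F₂ φ →
      PreFrobenioid.IsPreStep F₁ (Ψ.inverse.map φ))
    {N₁ : C₁} (hN₁ : ¬ PreFrobenioid.IsGroupLikeObj F₁ N₁) {N₂ : C₂}
    (hN₂ : ¬ PreFrobenioid.IsGroupLikeObj F₂ N₂) {A B : C₁} {φ : A ⟶ B}
    (hφ : PreFrobenioid.IsIsometry F₁ φ) : PreFrobenioid.IsIsometry F₂ (Ψ.functor.map φ) := by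
  have hP₁ := hF₁.isPreFrobenioid
  obtain ⟨X, Y, γ, β, α, hfac, hγ, hβ, hα⟩ := hF₁.iv_a_exists φ
  have h : PreFrobenioid.IsIsometry F₁ (γ ≫ β ≫ α) := by rw [hfac]; exact hφ
  have hβi : PreFrobenioid.IsIsometry F₁ β :=
    (PreFrobenioid.isIsometry_factors F₁ hP₁ (PreFrobenioid.isIsometry_factors F₁ hP₁ h).1).2
  rw [← hfac, Functor.map_comp, Functor.map_comp]
  exact PreFrobenioid.IsIsometry.comp F₂
    (isFrobeniusType_map_quasiIsotropic hF₁ hF₂ hq₁ hq₂ hnd₁ hnd₂ Ψ hΨ hΨ' hN₁ hN₂ hγ).1.2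
    (PreFrobenioid.IsIsometry.comp F₂ (isIsometry_isPreStep_map hF₁ hF₂ hq₁ hq₂ Ψ hβi hβ).1
      (hF₂.iv_b _ (isPullbackMorphism_map_quasiIsotropic hF₁ hF₂ hq₁ hq₂ hnd₁ hnd₂ Ψ hΨ hΨ' hN₁ hN₂
        hα)).1.2)

/-- **Thm. 3.4 (iii): `Ψ` preserves co-angular morphisms** (quasi-isotropic type; Def. 1.2 (iii): the
test factorisations in `C₂` pull back along `Ψ⁻¹`, whose parts keep their type: linear, isometric
pre-step, base-isomorphism). [cite: MochizukiFrdI2008, Thm. 3.4 (iii) p.64] -/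
theorem isCoAngular_map_quasiIsotropic (hF₁ : PreFrobenioid.IsFrobenioid F₁)
    (hF₂ : PreFrobenioid.IsFrobenioid F₂) (hq₁ : (PreFrobenioidData.ofFunctor Φ₁ F₁).IsOfQuasiIsotropicType)
    (hq₂ : (PreFrobenioidData.ofFunctor Φ₂ F₂).IsOfQuasiIsotropicType) (hnd₁ : IsNonDilatingOn Φ₁)
    (hnd₂ : IsNonDilatingOn Φ₂) (Ψ : C₁ ≌ C₂)
    (hΨ : ∀ ⦃A B : C₁⦄ ⦃φ : A ⟶ B⦄, PreFrobenioid.IsPreStep F₁ φ →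
      PreFrobenioid.IsPreStep F₂ (Ψ.functor.map φ))
    (hΨ' : ∀ ⦃A B : C₂⦄ ⦃φ : A ⟶ B⦄, PreFrobenioid.IsPreStep F₂ φ →
      PreFrobenioid.IsPreStep F₁ (Ψ.inverse.map φ))
    {N₁ : C₁} (hN₁ : ¬ PreFrobenioid.IsGroupLikeObj F₁ N₁) {N₂ : C₂}
    (hN₂ : ¬ PreFrobenioid.IsGroupLikeObj F₂ N₂) {A B : C₁} {φ : A ⟶ B}
    (hφ : PreFrobenioid.IsCoAngular F₁ φ) : PreFrobenioid.IsCoAngular F₂ (Ψ.functor.map φ) := by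
  have hP₁ := hF₁.isPreFrobenioid
  intro X' Y' γ' β' α' hfac hα' hβ'i hβ'p hbi
  -- pull the factorisation back to `C₁`
  have key : Ψ.unit.app A ≫ Ψ.inverse.map γ' ≫ Ψ.inverse.map β' ≫ Ψ.inverse.map α' ≫ Ψ.unitInv.app B = φ := by
    rw [← Ψ.inverse.map_comp_assoc, ← Ψ.inverse.map_comp_assoc, Category.assoc, hfac, Ψ.inv_fun_map]
    simp
  have hfac₁ : (Ψ.unit.app A ≫ Ψ.inverse.map γ') ≫ Ψ.inverse.map β' ≫
      (Ψ.inverse.map α' ≫ Ψ.unitInv.app B) = φ := by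
    simpa only [Category.assoc] using key
  have hα₁ : PreFrobenioid.IsLinear F₁ (Ψ.inverse.map α' ≫ Ψ.unitInv.app B) :=
    PreFrobenioid.IsLinear.comp F₁
      (isLinear_map_quasiIsotropic hF₂ hF₁ hq₂ hq₁ hnd₂ hnd₁ Ψ.symm hΨ' hΨ hN₂ hN₁ hα')
      (PreFrobenioid.isLinear_of_isIso F₁ _)
  obtain ⟨hβ₁i, hβ₁p⟩ := isIsometry_isPreStep_map hF₂ hF₁ hq₂ hq₁ Ψ.symm hβ'i hβ'p
  have hbi₁ : PreFrobenioid.IsBaseIso F₁ (Ψ.inverse.map α' ≫ Ψ.unitInv.app B) ∨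
      PreFrobenioid.IsBaseIso F₁ (Ψ.unit.app A ≫ Ψ.inverse.map γ') := by
    rcases hbi with h | h
    · exact Or.inl (PreFrobenioid.IsBaseIso.comp F₁
        (isBaseIso_map_quasiIsotropic hF₂ hF₁ hq₂ hq₁ hnd₂ hnd₁ Ψ.symm hΨ' hΨ hN₂ hN₁ h)
        (PreFrobenioid.isBaseIso_of_isIso F₁ _))
    · exact Or.inr (PreFrobenioid.IsBaseIso.comp F₁ (PreFrobenioid.isBaseIso_of_isIso F₁ _)
        (isBaseIso_map_quasiIsotropic hF₂ hF₁ hq₂ hq₁ hnd₂ hnd₁ Ψ.symm hΨ' hΨ hN₂ hN₁ h))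
  haveI := hφ _ _ _ hfac₁ hα₁ hβ₁i hβ₁p hbi₁
  exact isIso_of_fully_faithful Ψ.inverse β'

/-- **Thm. 3.4 (iii): `Ψ` preserves LB-invertible morphisms** (quasi-isotropic type).
[cite: MochizukiFrdI2008, Thm. 3.4 (iii) p.64] -/
theorem isLBInvertible_map_quasiIsotropic (hF₁ : PreFrobenioid.IsFrobenioid F₁)
    (hF₂ : PreFrobenioid.IsFrobenioid F₂) (hq₁ : (PreFrobenioidData.ofFunctor Φ₁ F₁).IsOfQuasiIsotropicType)
    (hq₂ : (PreFrobenioidData.ofFunctor Φ₂ F₂).IsOfQuasiIsotropicType) (hnd₁ : IsNonDilatingOn Φ₁)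
    (hnd₂ : IsNonDilatingOn Φ₂) (Ψ : C₁ ≌ C₂)
    (hΨ : ∀ ⦃A B : C₁⦄ ⦃φ : A ⟶ B⦄, PreFrobenioid.IsPreStep F₁ φ →
      PreFrobenioid.IsPreStep F₂ (Ψ.functor.map φ))
    (hΨ' : ∀ ⦃A B : C₂⦄ ⦃φ : A ⟶ B⦄, PreFrobenioid.IsPreStep F₂ φ →
      PreFrobenioid.IsPreStep F₁ (Ψ.inverse.map φ))
    {N₁ : C₁} (hN₁ : ¬ PreFrobenioid.IsGroupLikeObj F₁ N₁) {N₂ : C₂}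
    (hN₂ : ¬ PreFrobenioid.IsGroupLikeObj F₂ N₂) {A B : C₁} {φ : A ⟶ B}
    (hφ : PreFrobenioid.IsLBInvertible F₁ φ) : PreFrobenioid.IsLBInvertible F₂ (Ψ.functor.map φ) :=
  ⟨isCoAngular_map_quasiIsotropic hF₁ hF₂ hq₁ hq₂ hnd₁ hnd₂ Ψ hΨ hΨ' hN₁ hN₂ hφ.1,
    isIsometry_map_quasiIsotropic hF₁ hF₂ hq₁ hq₂ hnd₁ hnd₂ Ψ hΨ hΨ' hN₁ hN₂ hφ.2⟩

/-! ### Packaging in the vocabulary of the §3 statement files (`PreFrobenioidData.ofFunctor`) -/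

/-- **Thm. 3.4 (iii), morphism part, from Thm. 3.4 (ii)** in the shape of the typed statement
`PreFrobenioidData.Thm34iii`: for Frobenioids of quasi-isotropic type with non-dilating divisor monoids
and non-group-like objects on both sides (standard type (a), (e); not of group-like type), IF `Ψ` and
`Ψ⁻¹` preserve pre-steps (the first clause of the conclusion of `PreFrobenioidData.Thm34ii` for `Ψ` and
for `Ψ⁻¹`), THEN `Ψ` preserves morphisms of Frobenius type, linear morphisms, base-isomorphisms,
co-angular morphisms, pull-back morphisms, isometries and LB-invertible morphisms, and `Ψ^{ℕ≥1}` is the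
identity ("follows formally from (ii)", p. 64). [cite: MochizukiFrdI2008, Thm. 3.4 (iii) p.62] -/
theorem thm34iii_morphisms (hF₁ : PreFrobenioid.IsFrobenioid F₁)
    (hF₂ : PreFrobenioid.IsFrobenioid F₂) (hq₁ : (PreFrobenioidData.ofFunctor Φ₁ F₁).IsOfQuasiIsotropicType)
    (hq₂ : (PreFrobenioidData.ofFunctor Φ₂ F₂).IsOfQuasiIsotropicType)
    (hnd₁ : (PreFrobenioidData.ofFunctor Φ₁ F₁).IsNonDilatingOn)
    (hnd₂ : (PreFrobenioidData.ofFunctor Φ₂ F₂).IsNonDilatingOn) (Ψ : C₁ ≌ C₂)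
    (h₁₂ : PreFrobenioidData.PreservesMor Ψ.functor (PreFrobenioidData.ofFunctor Φ₁ F₁).IsPreStep
      (PreFrobenioidData.ofFunctor Φ₂ F₂).IsPreStep)
    (h₂₁ : PreFrobenioidData.PreservesMor Ψ.inverse (PreFrobenioidData.ofFunctor Φ₂ F₂).IsPreStep
      (PreFrobenioidData.ofFunctor Φ₁ F₁).IsPreStep)
    (hN₁ : ∃ A : C₁, ¬ (PreFrobenioidData.ofFunctor Φ₁ F₁).IsGroupLikeObj A)
    (hN₂ : ∃ A : C₂, ¬ (PreFrobenioidData.ofFunctor Φ₂ F₂).IsGroupLikeObj A) :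
    (PreFrobenioidData.PreservesMor Ψ.functor (PreFrobenioidData.ofFunctor Φ₁ F₁).IsFrobeniusType
        (PreFrobenioidData.ofFunctor Φ₂ F₂).IsFrobeniusType ∧
      PreFrobenioidData.PreservesMor Ψ.functor (PreFrobenioidData.ofFunctor Φ₁ F₁).IsLinear
        (PreFrobenioidData.ofFunctor Φ₂ F₂).IsLinear ∧
      PreFrobenioidData.PreservesMor Ψ.functor (PreFrobenioidData.ofFunctor Φ₁ F₁).IsBaseIso
        (PreFrobenioidData.ofFunctor Φ₂ F₂).IsBaseIso ∧
      PreFrobenioidData.PreservesMor Ψ.functor (PreFrobenioidData.ofFunctor Φ₁ F₁).IsCoAngular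
        (PreFrobenioidData.ofFunctor Φ₂ F₂).IsCoAngular ∧
      PreFrobenioidData.PreservesMor Ψ.functor (PreFrobenioidData.ofFunctor Φ₁ F₁).IsPullbackMorphism
        (PreFrobenioidData.ofFunctor Φ₂ F₂).IsPullbackMorphism ∧
      PreFrobenioidData.PreservesMor Ψ.functor (PreFrobenioidData.ofFunctor Φ₁ F₁).IsIsometry
        (PreFrobenioidData.ofFunctor Φ₂ F₂).IsIsometry ∧
      PreFrobenioidData.PreservesMor Ψ.functor (PreFrobenioidData.ofFunctor Φ₁ F₁).IsLBInvertible
        (PreFrobenioidData.ofFunctor Φ₂ F₂).IsLBInvertible) ∧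
    ∃ ΨN : ℕ+ ≃* ℕ+, (∀ ⦃A B : C₁⦄ (φ : A ⟶ B),
        (PreFrobenioidData.ofFunctor Φ₂ F₂).degFr (Ψ.functor.map φ) =
          ΨN ((PreFrobenioidData.ofFunctor Φ₁ F₁).degFr φ)) ∧ ΨN = MulEquiv.refl ℕ+ := by
  obtain ⟨N₁, hN₁⟩ := hN₁
  obtain ⟨N₂, hN₂⟩ := hN₂
  rw [PreFrobenioidData.ofFunctor_isGroupLikeObj] at hN₁ hN₂
  have hn₁ := isNonDilatingOn_of_ofFunctor hnd₁
  have hn₂ := isNonDilatingOn_of_ofFunctor hnd₂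
  have hΨ : ∀ ⦃A B : C₁⦄ ⦃φ : A ⟶ B⦄, PreFrobenioid.IsPreStep F₁ φ →
      PreFrobenioid.IsPreStep F₂ (Ψ.functor.map φ) := fun A B φ hφ => h₁₂ φ hφ
  have hΨ' : ∀ ⦃A B : C₂⦄ ⦃φ : A ⟶ B⦄, PreFrobenioid.IsPreStep F₂ φ →
      PreFrobenioid.IsPreStep F₁ (Ψ.inverse.map φ) := fun A B φ hφ => h₂₁ φ hφ
  refine ⟨⟨fun A B φ hφ => ?_, fun A B φ hφ => ?_, fun A B φ hφ => ?_, fun A B φ hφ => ?_,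
    fun A B φ hφ => ?_, fun A B φ hφ => ?_, fun A B φ hφ => ?_⟩, MulEquiv.refl ℕ+, fun A B φ => ?_, rfl⟩
  · rw [PreFrobenioidData.ofFunctor_isFrobeniusType] at hφ ⊢
    exact isFrobeniusType_map_quasiIsotropic hF₁ hF₂ hq₁ hq₂ hn₁ hn₂ Ψ hΨ hΨ' hN₁ hN₂ hφ
  · exact isLinear_map_quasiIsotropic hF₁ hF₂ hq₁ hq₂ hn₁ hn₂ Ψ hΨ hΨ' hN₁ hN₂ hφ
  · exact isBaseIso_map_quasiIsotropic hF₁ hF₂ hq₁ hq₂ hn₁ hn₂ Ψ hΨ hΨ' hN₁ hN₂ hφ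
  · rw [PreFrobenioidData.ofFunctor_isCoAngular] at hφ ⊢
    exact isCoAngular_map_quasiIsotropic hF₁ hF₂ hq₁ hq₂ hn₁ hn₂ Ψ hΨ hΨ' hN₁ hN₂ hφ
  · rw [PreFrobenioidData.ofFunctor_isPullbackMorphism] at hφ ⊢
    exact isPullbackMorphism_map_quasiIsotropic hF₁ hF₂ hq₁ hq₂ hn₁ hn₂ Ψ hΨ hΨ' hN₁ hN₂ hφ
  · exact isIsometry_map_quasiIsotropic hF₁ hF₂ hq₁ hq₂ hn₁ hn₂ Ψ hΨ hΨ' hN₁ hN₂ hφ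
  · rw [PreFrobenioidData.ofFunctor_isLBInvertible] at hφ ⊢
    exact isLBInvertible_map_quasiIsotropic hF₁ hF₂ hq₁ hq₂ hn₁ hn₂ Ψ hΨ hΨ' hN₁ hN₂ hφ
  · exact degFr_map hF₁ hF₂ hq₁ hq₂ hn₁ hn₂ Ψ hΨ hΨ' hN₁ hN₂ φ

end Two

end OfPreSteps

end FrdI

end Literature.AlgebraicGeometry.Frobenioids
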